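import Literature.AlgebraicGeometry.HodgeTheory.ComplexTorusIntegralHodgeClassesCorrespondenceExteriorProduct
import HarnessLib

/-!
# Intersection numbers of exterior products of correspondences: `(α × β) · (α′ × β′) = (α · α′) × (β · β′)`, `deg(α × β) = deg α · deg β`, `Λ(f × g) = Λ(f) Λ(g)`

Sequel of g29-#4 (`ComplexTorusIntegralHodgeClassesCorrespondenceExteriorProduct`: the exterior product `α × β = q_{XY}^*α · q_{X′Y′}^*β` of correspondences on
the integral Hodge carriers `Hdg•(−, ℤ)` of complex tori, `[Γ_{f×g}] = [Γ_f] × [Γ_g]`, `[Δ_{X×X′}] = [Δ_X] × [Δ_{X′}]`) and g27-#1 (`…ExteriorProduct`: `deg_{X×Y}(γ ⊠ δ)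
= deg_X γ · deg_Y δ`, Fulton's "`∫_{X×Y} α × β = ∫_X α · ∫_Y β`"). The tensor product of Fulton's category of correspondences (Example 16.1.12) is compatible
with the intersection product and with degrees:

* §1 **`integralHodgeClassesCup_corrCross_corrCross`** — **`(α × β) · (α′ × β′) = (α · α′) × (β · β′)`** on `(X × X′) × (Y × Y′)` (`q^*` is a ring map; graded
  commutativity in even degrees);
* §2 **`integralHodgeClassesDeg_corrCross`** — **`deg_{(X×X′)×(Y×Y′)}(α × β) = deg_{X×Y}(α) · deg_{X′×Y′}(β)`** for top-degree `α`, `β` (`α × β = t^*(α ⊠ β)` for the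
  middle-four interchange `t`, `deg ∘ t^* = deg` since `t_* t^* = 1` and `deg ∘ t_* = deg`, then Fubini g27-#1);
* §3 **`integralHodgeClassesDeg_graphClass_prodMap_cup_diagonalClass_prod`** — **`deg([Γ_{f×g}] · [Δ_{X×X′}]) = deg([Γ_f] · [Δ_X]) · deg([Γ_g] · [Δ_{X′}])`** for
  endomorphisms `f` of `X` and `g` of `X′`: THE LEFSCHETZ NUMBER IS MULTIPLICATIVE, `Λ(f × g) = Λ(f) · Λ(g)` (Fulton Example 16.1.15 "`∫_{X×X} α · Δ`" for `α = Γ_{f×g} =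
  Γ_f × Γ_g`, with `Δ_{X×X′} = Δ_X × Δ_{X′}`, §1 and §2).

Everything is a theorem; no definition, no named fact (D-0026). Frames arbitrary up to the typing of the degree maps (`deg_V` is read in a frame `Fin (2 dim V)`).

## References
* [Fulton1998] W. Fulton, Intersection Theory, 2nd ed., Springer 1998, §16.1 Example 16.1.12 (p0300 L9–L12, p0301 L9), Example 16.1.15 (p0302 L27–L42), §1.10
  Prop. 1.10 (b) and Example 1.10.1 (p0035 L20–L33), Example 1.7.4 (p0031 L17–L21), §1.4 Def. 1.4 (p0025 L1–L9).
* [Lange2023AbelianVarietiesComplex] H. Lange, Abelian Varieties over the Complex Numbers, Springer 2023, §6.2.2 (p0303–p0304), §6.2.4 (6.10) (p0310 L33–L35).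
-/

noncomputable section

open CategoryTheory Function

namespace Literature.AlgebraicGeometry.HodgeTheory

open Literature.AlgebraicGeometry.Motives Literature.AlgebraicGeometry.Motives.HodgeStructure
open Literature.Geometry.Kaehler Literature.Geometry.Kaehler.ComplexTorus

namespace ComplexTorusCat

section Shuffle

variable {ι : Type} {E : Type} [NormedAddCommGroup E] [NormedSpace ℂ E] (Φ : (ι → ℝ) ≃L[ℝ] E)

/-- `(α · β) · (x · y) = (α · x) · (β · y)` in the commutative graded ring `Hdg•(−, ℤ)`. [folklore] -/
private theorem cup_cup_cup_comm₉ {a a' A p p' Q C s s' : ℕ} (haa' : a + a' = A) (hpp' : p + p' = Q) (hAQ : A + Q = C) (hap : a + p = s)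
    (ha'p' : a' + p' = s') (hss' : s + s' = C) (α : integralHodgeClasses Φ a) (β : integralHodgeClasses Φ a') (x : integralHodgeClasses Φ p)
    (y : integralHodgeClasses Φ p') :
    integralHodgeClassesCup Φ hAQ (integralHodgeClassesCup Φ haa' α β) (integralHodgeClassesCup Φ hpp' x y) =
      integralHodgeClassesCup Φ hss' (integralHodgeClassesCup Φ hap α x) (integralHodgeClassesCup Φ ha'p' β y) := by
  rw [integralHodgeClassesCup_assoc Φ haa' hAQ (rfl : a' + Q = a' + Q) (by omega : a + (a' + Q) = C),
    ← integralHodgeClassesCup_assoc Φ (rfl : a' + p = a' + p) (by omega : (a' + p) + p' = a' + Q) hpp' (rfl : a' + Q = a' + Q),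
    integralHodgeClassesCup_comm Φ (by omega : p + a' = a' + p) (rfl : a' + p = a' + p),
    integralHodgeClassesCup_assoc Φ (by omega : p + a' = a' + p) (by omega : (a' + p) + p' = a' + Q) ha'p' (by omega : p + s' = a' + Q),
    ← integralHodgeClassesCup_assoc Φ hap hss' (by omega : p + s' = a' + Q) (by omega : a + (a' + Q) = C)]

end Shuffle

/-! ## §1 `(α × β) · (α′ × β′) = (α · α′) × (β · β′)` -/

section Cup

variable {X X' Y Y' : ComplexTorusCat} {a a' A b b' B C ab ab' : ℕ} (haa' : a + a' = A) (hbb' : b + b' = B) (hAB : A + B = C) (hab : a + b = ab)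
  (ha'b' : a' + b' = ab') (hCC : ab + ab' = C)

/-- **`(α × β) · (α′ × β′) = (α · α′) × (β · β′)`** in `Hdg•((X × X′) × (Y × Y′), ℤ)` for `α ∈ Hdgᵃ(X × Y, ℤ)`, `α′ ∈ Hdgᵇ(X × Y, ℤ)`, `β ∈ Hdg^{a′}(X′ × Y′, ℤ)`,
`β′ ∈ Hdg^{b′}(X′ × Y′, ℤ)`: the exterior product of correspondences is multiplicative for the intersection products (`q_{XY}^*`, `q_{X′Y′}^*` are ring maps and
`Hdg^{2•}` is commutative). [cite: Fulton1998, §16.1 Example 16.1.12 (p0300 L9–L12) and §1.10 Example 1.10.1 / Example 8.3.7 (p0035, p0133 L30)] -/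
theorem integralHodgeClassesCup_corrCross_corrCross (α : integralHodgeClasses (prodObj X Y).toIsog.Φ a) (β : integralHodgeClasses (prodObj X' Y').toIsog.Φ a')
    (α' : integralHodgeClasses (prodObj X Y).toIsog.Φ b) (β' : integralHodgeClasses (prodObj X' Y').toIsog.Φ b') :
    integralHodgeClassesCup (prodObj (prodObj X X') (prodObj Y Y')).toIsog.Φ hAB
        (integralHodgeClassesCup (prodObj (prodObj X X') (prodObj Y Y')).toIsog.Φ haa'
          (integralHodgeClassesPullbackHom
            (liftHom (fstHom (prodObj X X') (prodObj Y Y') ≫ fstHom X X') (sndHom (prodObj X X') (prodObj Y Y') ≫ fstHom Y Y')) a α)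
          (integralHodgeClassesPullbackHom
            (liftHom (fstHom (prodObj X X') (prodObj Y Y') ≫ sndHom X X') (sndHom (prodObj X X') (prodObj Y Y') ≫ sndHom Y Y')) a' β))
        (integralHodgeClassesCup (prodObj (prodObj X X') (prodObj Y Y')).toIsog.Φ hbb'
          (integralHodgeClassesPullbackHom
            (liftHom (fstHom (prodObj X X') (prodObj Y Y') ≫ fstHom X X') (sndHom (prodObj X X') (prodObj Y Y') ≫ fstHom Y Y')) b α')
          (integralHodgeClassesPullbackHom
            (liftHom (fstHom (prodObj X X') (prodObj Y Y') ≫ sndHom X X') (sndHom (prodObj X X') (prodObj Y Y') ≫ sndHom Y Y')) b' β')) =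
      integralHodgeClassesCup (prodObj (prodObj X X') (prodObj Y Y')).toIsog.Φ hCC
        (integralHodgeClassesPullbackHom
          (liftHom (fstHom (prodObj X X') (prodObj Y Y') ≫ fstHom X X') (sndHom (prodObj X X') (prodObj Y Y') ≫ fstHom Y Y')) ab
          (integralHodgeClassesCup (prodObj X Y).toIsog.Φ hab α α'))
        (integralHodgeClassesPullbackHom
          (liftHom (fstHom (prodObj X X') (prodObj Y Y') ≫ sndHom X X') (sndHom (prodObj X X') (prodObj Y Y') ≫ sndHom Y Y')) ab'
          (integralHodgeClassesCup (prodObj X' Y').toIsog.Φ ha'b' β β')) := by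
  rw [integralHodgeClassesPullbackHom_cup, integralHodgeClassesPullbackHom_cup]
  exact cup_cup_cup_comm₉ _ haa' hbb' hAB hab ha'b' hCC _ _ _ _

end Cup

/-! ## §2 `deg(α × β) = deg α · deg β` -/

section Degree

variable (X X' Y Y' : ComplexTorusCat) {gXY gX'Y' GP : ℕ} (hG : gXY + gX'Y' = GP) (eXY : Fin (2 * gXY) ≃ (prodObj X Y).toIsog.ι)
  (eX'Y' : Fin (2 * gX'Y') ≃ (prodObj X' Y').toIsog.ι) (eP : Fin (2 * GP) ≃ (prodObj (prodObj X X') (prodObj Y Y')).toIsog.ι) (hgPP : GP + GP = 2 * GP)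

include hgPP in
/-- **`deg_{(X×X′)×(Y×Y′)}(α × β) = deg_{X×Y}(α) · deg_{X′×Y′}(β)`** for top-degree correspondences `α ∈ Hdg^{dim(X×Y)}(X × Y, ℤ)`, `β ∈ Hdg^{dim(X′×Y′)}(X′ × Y′, ℤ)`:
`α × β = t^*(α ⊠ β)` for the middle-four interchange `t : (X × X′) × (Y × Y′) ⥲ (X × Y) × (X′ × Y′)` (g29-#4), `deg(t^*u) = deg(t_* t^* u) = deg(u)` (`∫_X α = ∫_Y
f_*α`, g25-#2/g27 `integralHodgeClassesDeg_pushforward`; `t_* t^* = 1`, Example 1.7.4) and Fubini `deg(α ⊠ β) = deg α · deg β` (g27-#1).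
[cite: Fulton1998, §1.10 Prop. 1.10 (b) and Example 1.10.1 (p0035 L20–L33), §1.4 Def. 1.4 (p0025 L1–L9)] [cite: Lange2023AbelianVarietiesComplex, §6.2.4 (6.10) (p0310 L33–L35)] -/
theorem integralHodgeClassesDeg_corrCross (α : integralHodgeClasses (prodObj X Y).toIsog.Φ gXY) (β : integralHodgeClasses (prodObj X' Y').toIsog.Φ gX'Y') :
    integralHodgeClassesDeg (prodObj (prodObj X X') (prodObj Y Y')) eP
        (integralHodgeClassesCup (prodObj (prodObj X X') (prodObj Y Y')).toIsog.Φ hG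
          (integralHodgeClassesPullbackHom
            (liftHom (fstHom (prodObj X X') (prodObj Y Y') ≫ fstHom X X') (sndHom (prodObj X X') (prodObj Y Y') ≫ fstHom Y Y')) gXY α)
          (integralHodgeClassesPullbackHom
            (liftHom (fstHom (prodObj X X') (prodObj Y Y') ≫ sndHom X X') (sndHom (prodObj X X') (prodObj Y Y') ≫ sndHom Y Y')) gX'Y' β)) =
      integralHodgeClassesDeg (prodObj X Y) eXY α * integralHodgeClassesDeg (prodObj X' Y') eX'Y' β := by
  let eM : Fin (2 * GP) ≃ (prodObj (prodObj X Y) (prodObj X' Y')).toIsog.ι := eP.trans (Equiv.sumSumSumComm X.toIsog.ι X'.toIsog.ι Y.toIsog.ι Y'.toIsog.ι)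
  haveI : IsIso (liftHom (liftHom (fstHom (prodObj X X') (prodObj Y Y') ≫ fstHom X X') (sndHom (prodObj X X') (prodObj Y Y') ≫ fstHom Y Y'))
      (liftHom (fstHom (prodObj X X') (prodObj Y Y') ≫ sndHom X X') (sndHom (prodObj X X') (prodObj Y Y') ≫ sndHom Y Y'))) :=
    ⟨⟨_, middleFour_comp_middleFour X X' Y Y', middleFour_comp_middleFour X Y X' Y'⟩⟩
  rw [← integralHodgeClassesPullbackHom_liftHom_cross,
    ← integralHodgeClassesDeg_pushforward
      (liftHom (liftHom (fstHom (prodObj X X') (prodObj Y Y') ≫ fstHom X X') (sndHom (prodObj X X') (prodObj Y Y') ≫ fstHom Y Y'))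
        (liftHom (fstHom (prodObj X X') (prodObj Y Y') ≫ sndHom X X') (sndHom (prodObj X X') (prodObj Y Y') ≫ sndHom Y Y')))
      eP eM (Nat.zero_add _) hgPP (Nat.zero_add _) hgPP,
    integralHodgeClassesPushforward_pullbackHom_of_isIso, integralHodgeClassesDeg_integralHodgeClassesCross (prodObj X Y) (prodObj X' Y') hG eXY eX'Y' eM]

end Degree

/-! ## §3 `Λ(f × g) = Λ(f) · Λ(g)`: `deg([Γ_{f×g}] · [Δ_{X×X′}]) = deg([Γ_f] · [Δ_X]) · deg([Γ_g] · [Δ_{X′}])` -/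

section Lefschetz

variable (X X' : ComplexTorusCat) (f : X ⟶ X) (g : X' ⟶ X') {gX gX' gXX gX'X' G GP : ℕ} (hG : gX + gX' = G) (hGG : G + G = GP)
  (eX : Fin (2 * gX) ≃ X.toIsog.ι) (eXX : Fin (2 * gXX) ≃ (prodObj X X).toIsog.ι)
  (hX0 : 2 * gX + 2 * 0 = 2 * gX) (hgX : gX + gX = 2 * gX) (hcX : 2 * gX + 2 * gX = 2 * gXX) (hgXX : gXX + gXX = 2 * gXX) (hggX : gX + gX = gXX)
  (eX' : Fin (2 * gX') ≃ X'.toIsog.ι) (eX'X' : Fin (2 * gX'X') ≃ (prodObj X' X').toIsog.ι)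
  (hX'0 : 2 * gX' + 2 * 0 = 2 * gX') (hgX' : gX' + gX' = 2 * gX') (hcX' : 2 * gX' + 2 * gX' = 2 * gX'X') (hgX'X' : gX'X' + gX'X' = 2 * gX'X')
  (hggX' : gX' + gX' = gX'X')
  (eXX' : Fin (2 * G) ≃ (prodObj X X').toIsog.ι) (ePP : Fin (2 * GP) ≃ (prodObj (prodObj X X') (prodObj X X')).toIsog.ι)
  (hP0 : 2 * G + 2 * 0 = 2 * G) (hgP : G + G = 2 * G) (hcP : 2 * G + 2 * G = 2 * GP) (hgPP : GP + GP = 2 * GP)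

include hG eX eX' hgX hgX' in
/-- **THE LEFSCHETZ NUMBER IS MULTIPLICATIVE: `deg([Γ_{f×g}] · [Δ_{X×X′}]) = deg([Γ_f] · [Δ_X]) · deg([Γ_g] · [Δ_{X′}])`**, i.e. `Λ(f × g) = Λ(f) · Λ(g)` for endomorphisms
`f` of `X`, `g` of `X′` (Fulton Example 16.1.15: `∫ Γ · Δ` is the Lefschetz number): `[Γ_{f×g}] = [Γ_f] × [Γ_g]`, `[Δ_{X×X′}] = [Δ_X] × [Δ_{X′}]` (g29-#4), §1 and §2.
[cite: Fulton1998, §16.1 Example 16.1.15 (p0302 L27–L42) and Example 16.1.12 (p0300 L9–L12)] [cite: Fulton1998, §1.10 Prop. 1.10 (b) (p0035 L20–L28)] -/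
theorem integralHodgeClassesDeg_graphClass_prodMap_cup_diagonalClass_prod :
    integralHodgeClassesDeg (prodObj (prodObj X X') (prodObj X X')) ePP
        (integralHodgeClassesCup (prodObj (prodObj X X') (prodObj X X')).toIsog.Φ hGG
          (integralHodgeClassesPushforward 0 G (graphHom (prodMap f g)) eXX' ePP hP0 hgP hcP hgPP (unitIntegralHodgeClass (prodObj X X')))
          (integralHodgeClassesPushforward 0 G (diagHom (prodObj X X')) eXX' ePP hP0 hgP hcP hgPP (unitIntegralHodgeClass (prodObj X X')))) =
      integralHodgeClassesDeg (prodObj X X) eXX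
          (integralHodgeClassesCup (prodObj X X).toIsog.Φ hggX
            (integralHodgeClassesPushforward 0 gX (graphHom f) eX eXX hX0 hgX hcX hgXX (unitIntegralHodgeClass X))
            (integralHodgeClassesPushforward 0 gX (diagHom X) eX eXX hX0 hgX hcX hgXX (unitIntegralHodgeClass X))) *
        integralHodgeClassesDeg (prodObj X' X') eX'X'
          (integralHodgeClassesCup (prodObj X' X').toIsog.Φ hggX'
            (integralHodgeClassesPushforward 0 gX' (graphHom g) eX' eX'X' hX'0 hgX' hcX' hgX'X' (unitIntegralHodgeClass X'))
            (integralHodgeClassesPushforward 0 gX' (diagHom X') eX' eX'X' hX'0 hgX' hcX' hgX'X' (unitIntegralHodgeClass X'))) := by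
  rw [integralHodgeClassesPushforward_graphHom_prodMap_unitIntegralHodgeClass f g hG eX eX' eX eX' eXX eX'X' eXX' eXX' ePP hX0 hgX hcX hgXX hX'0 hgX' hcX'
      hgX'X' hP0 hgP hcP hgPP,
    integralHodgeClassesPushforward_diagHom_prod_unitIntegralHodgeClass X X' eX eX' eXX' hX0 hgX hX'0 hgX' hP0 hgP hG eX eX' eXX eX'X' eXX' ePP hcX hgXX hcX'
      hgX'X' hcP hgPP,
    integralHodgeClassesCup_corrCross_corrCross hG hG hGG hggX hggX' (by omega : gXX + gX'X' = GP),
    integralHodgeClassesDeg_corrCross X X' X X' (by omega : gXX + gX'X' = GP) eXX eX'X' ePP hgPP]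

end Lefschetz

end ComplexTorusCat

end Literature.AlgebraicGeometry.HodgeTheory
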